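import Mathlib.Analysis.Calculus.ParametricIntegral
import Mathlib.Analysis.Normed.Group.Bounded
import Mathlib.Analysis.SpecialFunctions.SmoothTransition
import Summits.RiemannHypothesis.RiemannHypothesis.Theorems.WeilCombCombShapePositivityArchDiagBombieriBoundsK2

/-!
# Derivative of the bump autocorrelation under the integral sign
(crux `WeilComb.CombShapePositivity`, item stmt-RiemannHypothesis-11229, line `Sketch`; brick B0b of
`STUB-PLAN-stub_windowCore`: an analytic input of the certified diagonal constant `𝒞' = ∫₀² (N − P₀(s))/s ds`)

Notation. `φ₀(u) = expNegInvGlue (1 - u²)` is the fixed real bump (`= exp(−1/(1−u²))` on `(−1,1)`, `0` outside) and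
`P₀(s) = ∫ φ₀(u) φ₀(u − s) du` is its real autocorrelation; both are written inline.

Main result `stub_bumpAutocorr_hasDerivAt`: for every real `s`,
`P₀'(s) = ∫ φ₀(u) · (2(u − s)/(1 − (u − s)²)²) · φ₀(u − s) du`,
by differentiation under the integral sign (`hasDerivAt_integral_of_dominated_loc_of_deriv_le`) with the integrable
dominating function `u ↦ C‖φ₀(u)‖`, `C` a uniform bound of the continuous compactly supported function
`v ↦ (2v/(1 − v²)²) φ₀(v) = −φ₀'(v)`.

Ingredients, each valid at EVERY real argument thanks to Lean's conventions `x / 0 = 0`, `0⁻¹ = 0`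
(at `|v| = 1` the bump is flat and the closed forms vanish too):
* `hasDerivAt_expNegInvGlue_bumpAD`: `expNegInvGlue' x = expNegInvGlue x / x²`
  (Mathlib's `expNegInvGlue.hasDerivAt_polynomial_eval_inv_mul` at the constant polynomial `1`);
* `hasDerivAt_shapeBump_shift_bumpAD`: `d/ds φ₀(u − s) = (2(u − s)/(1 − (u − s)²)²) φ₀(u − s)` (chain rule);
* `continuous_bumpDeriv_bumpAD`, `exists_bound_bumpDeriv_bumpAD`: `v ↦ (2v/(1 − v²)²) φ₀(v)` is continuous
  (it is `2v · g(1 − v²)` with Mathlib's continuous `g(x) = x⁻² · expNegInvGlue x`) and vanishes off `[-1, 1]`,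
  hence is bounded.

NOT here: the Lipschitz bound of `P₀'` and every numerical enclosure (other bricks of the plan).
-/

noncomputable section

-- the sub-problem path RiemannHypothesis/RiemannHypothesis duplicates a namespace (D-0017)
set_option linter.dupNamespace false

open scoped Topology
open MeasureTheory Set Filter

namespace Summit.RiemannHypothesis.RiemannHypothesis.Theorems.WeilCombBohrFejer

/-! ### Pointwise derivative of the bump -/

/-- `expNegInvGlue` has derivative `expNegInvGlue x / x²` at every real `x` (for `x ≤ 0` the function vanishes
near `x`, resp. is flat at `0`, and the formula vanishes by `x / 0 = 0`). [folklore] -/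
theorem hasDerivAt_expNegInvGlue_bumpAD (x : ℝ) :
    HasDerivAt expNegInvGlue (expNegInvGlue x / x ^ 2) x := by
  have h := expNegInvGlue.hasDerivAt_polynomial_eval_inv_mul 1 x
  simp only [Polynomial.eval_one, one_mul, Polynomial.derivative_one, sub_zero, mul_one,
    Polynomial.eval_pow, Polynomial.eval_X] at h
  convert h using 1
  rw [inv_pow, div_eq_mul_inv, mul_comm]

/-- Chain rule: `s ↦ φ₀(u − s)` has derivative `(2(u − s)/(1 − (u − s)²)²) φ₀(u − s)` at every real `s`.
[folklore] -/
theorem hasDerivAt_shapeBump_shift_bumpAD (u s : ℝ) :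
    HasDerivAt (fun s : ℝ => expNegInvGlue (1 - (u - s) ^ 2))
      (2 * (u - s) / (1 - (u - s) ^ 2) ^ 2 * expNegInvGlue (1 - (u - s) ^ 2)) s := by
  have h1 : HasDerivAt (fun s : ℝ => 1 - (u - s) ^ 2) (2 * (u - s)) s := by
    have h := (((hasDerivAt_id' s).const_sub u).fun_pow 2).const_sub (1 : ℝ)
    refine h.congr_deriv ?_
    norm_num
  have h2 := (hasDerivAt_expNegInvGlue_bumpAD (1 - (u - s) ^ 2)).comp s h1
  refine h2.congr_deriv ?_
  ring

/-! ### The function `v ↦ (2v/(1 − v²)²) φ₀(v)` is continuous and bounded -/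

/-- `v ↦ (2v/(1 − v²)²) φ₀(v)` is continuous on `ℝ`: it is `2v · g(1 − v²)` with Mathlib's continuous
`g(x) = x⁻² · expNegInvGlue x`. [folklore] -/
theorem continuous_bumpDeriv_bumpAD :
    Continuous fun v : ℝ => 2 * v / (1 - v ^ 2) ^ 2 * expNegInvGlue (1 - v ^ 2) := by
  have hg : Continuous fun x : ℝ => x⁻¹ ^ 2 * expNegInvGlue x := by
    have h := expNegInvGlue.continuous_polynomial_eval_inv_mul ((Polynomial.X : Polynomial ℝ) ^ (2 : ℕ))
    simpa only [Polynomial.eval_pow, Polynomial.eval_X] using h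
  have h : Continuous fun v : ℝ => 2 * v * ((1 - v ^ 2)⁻¹ ^ 2 * expNegInvGlue (1 - v ^ 2)) :=
    (continuous_const.mul continuous_id).mul (hg.comp (continuous_const.sub (continuous_id.pow 2)))
  refine h.congr fun v => ?_
  rw [inv_pow, div_eq_mul_inv]
  ring

/-- `v ↦ (2v/(1 − v²)²) φ₀(v)` vanishes off `[-1, 1]`, hence has compact support. [folklore] -/
theorem hasCompactSupport_bumpDeriv_bumpAD :
    HasCompactSupport fun v : ℝ => 2 * v / (1 - v ^ 2) ^ 2 * expNegInvGlue (1 - v ^ 2) :=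
  hasCompactSupport_bumpR_diagBB.mul_left

/-- A uniform bound `‖(2v/(1 − v²)²) φ₀(v)‖ ≤ C` for all real `v` (continuous with compact support). [folklore] -/
theorem exists_bound_bumpDeriv_bumpAD :
    ∃ C : ℝ, ∀ v : ℝ, ‖2 * v / (1 - v ^ 2) ^ 2 * expNegInvGlue (1 - v ^ 2)‖ ≤ C :=
  continuous_bumpDeriv_bumpAD.bounded_above_of_compact_support hasCompactSupport_bumpDeriv_bumpAD

/-! ### Differentiation under the integral sign -/

/-- **Brick B0b input.** The bump autocorrelation `P₀(s) = ∫ φ₀(u) φ₀(u − s) du` is differentiable at every real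
`s`, with `P₀'(s) = ∫ φ₀(u) · (2(u − s)/(1 − (u − s)²)²) · φ₀(u − s) du` (dominated differentiation under the
integral sign on the whole line, dominating function `C‖φ₀‖`). [folklore] -/
theorem stub_bumpAutocorr_hasDerivAt : ∀ s : ℝ, HasDerivAt (fun s : ℝ => ∫ u : ℝ, expNegInvGlue (1 - u ^ 2) * expNegInvGlue (1 - (u - s) ^ 2)) (∫ u : ℝ, expNegInvGlue (1 - u ^ 2) * (2 * (u - s) / (1 - (u - s) ^ 2) ^ 2 * expNegInvGlue (1 - (u - s) ^ 2))) s := by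
  intro s₀
  obtain ⟨C, hC⟩ := exists_bound_bumpDeriv_bumpAD
  have hF_meas : ∀ s : ℝ, AEStronglyMeasurable
      (fun u : ℝ => expNegInvGlue (1 - u ^ 2) * expNegInvGlue (1 - (u - s) ^ 2)) volume := fun s =>
    (continuous_shapeBump.mul
      (continuous_shapeBump.comp (continuous_id.sub continuous_const))).aestronglyMeasurable
  have hF'_meas : AEStronglyMeasurable (fun u : ℝ => expNegInvGlue (1 - u ^ 2) *
      (2 * (u - s₀) / (1 - (u - s₀) ^ 2) ^ 2 * expNegInvGlue (1 - (u - s₀) ^ 2))) volume :=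
    (continuous_shapeBump.mul
      (continuous_bumpDeriv_bumpAD.comp (continuous_id.sub continuous_const))).aestronglyMeasurable
  have hbound : Integrable (fun u : ℝ => ‖expNegInvGlue (1 - u ^ 2)‖ * C) volume :=
    (continuous_shapeBump.norm.mul continuous_const).integrable_of_hasCompactSupport
      hasCompactSupport_bumpR_diagBB.norm.mul_right
  exact (hasDerivAt_integral_of_dominated_loc_of_deriv_le (μ := volume) (x₀ := s₀)
    (bound := fun u : ℝ => ‖expNegInvGlue (1 - u ^ 2)‖ * C)
    (F := fun s u : ℝ => expNegInvGlue (1 - u ^ 2) * expNegInvGlue (1 - (u - s) ^ 2))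
    (F' := fun s u : ℝ => expNegInvGlue (1 - u ^ 2) *
      (2 * (u - s) / (1 - (u - s) ^ 2) ^ 2 * expNegInvGlue (1 - (u - s) ^ 2)))
    univ_mem (Eventually.of_forall hF_meas) (integrable_bumpR_mul_shift_diagBB s₀) hF'_meas
    (Eventually.of_forall fun u s _ =>
      (norm_mul_le _ _).trans (mul_le_mul_of_nonneg_left (hC (u - s)) (norm_nonneg _)))
    hbound
    (Eventually.of_forall fun u s _ => (hasDerivAt_shapeBump_shift_bumpAD u s).const_mul _)).2

end Summit.RiemannHypothesis.RiemannHypothesis.Theorems.WeilCombBohrFejer
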